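import Literature.NumberTheory.EllipticCurves.SupersingularInertiaShapeProofs
import HarnessLib

/-!
# Serre's additive `θ : E[p] ↪ k̄` at a place with `e = 1` and ANY residue degree, equivariant for the
# `(p² − 1)`-th Kummer character (Serre 1972 §1.10 Prop. 10, §1.11 Prop. 12 — the local statement)

Route `SignedLowerHalves`, child L `SmallImageLowerHalfBothSigns` (item stmt-BirchSwinnertonDyer-23599), line
proposal `rtt_w3`, stub K0₂@p `stub_heckeThetaPartner_ns` — brick AH5/S1 of the arithmetic half at an ODD prime
(width seat `bsd-line-slh-p3-w3` gen 9; memo `Lines/birth_acns-MEMO-w3-g9.md`).  THEOREMS ONLY (no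
definition, no named fact, no `sorry`); ROUTE-INDEPENDENT.

The tree's `WeierstrassCurve.exists_additive_equivariant_of_dvd_frobeniusTraceAt`
(`Literature/NumberTheory/EllipticCurves/SupersingularInertiaShapeProofs.lean`) is Serre's construction for a
number field `K` and a place `v ∣ p` of good supersingular reduction with `e(v ∣ p) = f(v ∣ p) = 1`: an
additive injective `θ : E[p] → k` with `θ(σX) = ψ₂(σ)θ(X)` on the inertia group of `K_v`, `ψ₂` the
LEVEL-TWO fundamental character (Kummer character of exponent `q² − 1 = p² − 1`).  Serre's local statement
("Supposons que `e = 1`") needs no hypothesis on the residue degree: the non-zero `p`-torsion points of the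
height-two formal group have `|z|^{p²−1} = |p|` whatever `f` is, and inertia acts through the Kummer
character of exponent `p² − 1` of the uniformiser `p` — which is `ψ₂` when `f = 1` and the LEVEL-ONE
fundamental character `ψ₁ = θ_{q−1}` when `f = 2` (`q = p²`).  This file records that variant,

* `exists_additive_equivariant_kummer_of_dvd_frobeniusTraceAt` — same hypotheses as the tree theorem minus
  `#k_v = p`, plus `0 < p² − 1`; conclusion with `kummerCharacter K_v (p² − 1) p ι` in place of `ψ₂`,

because the CM-partner construction at odd `p` (orientation input (O), CFT half) reads the inertia action on
`E[p]` at the INERT prime `𝔭 = p𝓞_K` of the dihedral imaginary quadratic field `K` (`f = 2`), where the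
local–global compatibility of class field theory and Lubin–Tate reciprocity live
(`artinCharacter_localGlobalCompatible`, `coe_lubinTateChar_toAbsGalois` for `K_𝔭 ≅ ℚ_{p²}`).  The proof
is the tree's, VERBATIM except for the exponent bookkeeping of Step 4
(-- adapted from Literature/NumberTheory/EllipticCurves/SupersingularInertiaShapeProofs.lean).

BSD, crux L and the stub are NOT proved here.

References: J.-P. Serre, Invent. Math. 15 (1972) §1.7 Prop. 3, §1.10 Prop. 10, §1.11 Prop. 12;
J. H. Silverman, AEC IV.1, VII.2.2.
-/

set_option autoImplicit false
set_option linter.dupNamespace false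

noncomputable section

open scoped Classical NNReal NumberField AddSubgroup
open NumberField IsDedekindDomain Polynomial

namespace Summit.BirchSwinnertonDyer.BirchSwinnertonDyer.Theorems.SmallImageLambdaLowerThreeNsThetaPartner

open _root_.WeierstrassCurve Literature.NumberTheory.GaloisRepresentations Field
  IsDedekindDomain.HeightOneSpectrum Literature.NumberTheory.EllipticCurves
  Literature.NumberTheory.GaloisRepresentations.IsNonarchimedeanLocalField
  Literature.NumberTheory.GaloisRepresentations.ModPGaloisRep ValuativeRel

set_option maxHeartbeats 400000 in
-- adapted from Literature/NumberTheory/EllipticCurves/SupersingularInertiaShapeProofs.lean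
/-- **Serre's additive embedding `θ : E[p] ↪ k` at a good supersingular place with `e = 1`, any residue
degree** (Serre 1972, §1.10 Prop. 10, §1.11 Prop. 12).  For an elliptic curve `W` over a number field `K`, an
odd prime `p`, a place `v ∣ p` of good reduction with `p ∣ a_v` and `𝔪_v = p𝓞_v` (`p` a uniformiser of
`K_v`), and a residue embedding `ι` into a field `k`: there is `θ : E(K̄) → k`, additive and injective on
`E[p]`, with `θ(σ X) = θ_{p²−1}(σ) θ(X)` for `σ` in the inertia group of `K_v` (through
`res : Γ_{K_v} → Γ_K`), `θ_{p²−1} = kummerCharacter K_v (p² − 1) p ι` the Kummer character of the uniformiser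
`p` of exponent `p² − 1` (= `ψ₂` if `#k_v = p`, = `ψ₁` if `#k_v = p²`).
[cite: SerreInventiones1972, §1.10 Prop. 10, §1.11 Prop. 12, §1.7 Prop. 3] -/
theorem exists_additive_equivariant_kummer_of_dvd_frobeniusTraceAt
    {K : Type} [Field K] [NumberField K]
    (W : WeierstrassCurve K) [W.IsElliptic] (p : ℕ) [hp : Fact p.Prime] (hp2 : p ≠ 2)
    (v : HeightOneSpectrum (𝓞 K)) (hpv : (p : 𝓞 K) ∈ v.asIdeal) (hgood : W.HasGoodReductionAt v)
    (hss : (p : ℤ) ∣ W.frobeniusTraceAt v)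
    (hgen : ∀ c ∈ IsLocalRing.maximalIdeal (v.adicCompletionIntegers K),
      ((p : ℕ) : v.adicCompletionIntegers K) ∣ c)
    {k : Type} [Field k]
    (hirr : Irreducible ((p : ℕ) : 𝒪[v.adicCompletion K]))
    (hn : 0 < p ^ 2 - 1)
    (ι : absIntegers 𝒪[v.adicCompletion K] (v.adicCompletion K) ⧸
      absMaximalIdeal (v.adicCompletion K) →+* k) :
    ∃ θ : geomPoints W → k,
      (∀ X ∈ geomTorsion W p, ∀ Y ∈ geomTorsion W p, θ (X + Y) = θ X + θ Y) ∧
      (∀ X ∈ geomTorsion W p, θ X = 0 → X = 0) ∧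
      (∀ (σ : absInertia (v.adicCompletion K)), ∀ X ∈ geomTorsion W p,
        θ (absGaloisRestrict K (v.adicCompletion K)
            (σ : absoluteGaloisGroup (v.adicCompletion K)) • X) =
          (kummerCharacter (v.adicCompletion K) hn hirr.ne_zero ι σ : k) * θ X) := by
  classical
  haveI : CharZero (v.adicCompletion K) :=
    charZero_of_injective_algebraMap (algebraMap K (v.adicCompletion K)).injective
  haveI : CharZero (AlgebraicClosure (v.adicCompletion K)) :=
    charZero_of_injective_algebraMap
      (algebraMap (v.adicCompletion K) (AlgebraicClosure (v.adicCompletion K))).injective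
  have hp0 : p ≠ 0 := hp.out.ne_zero
  /- Step 0: the local setup `w`, `MO = M.map φ`, `Φ = congrEquiv hX ∘ Φ₀`, `A = Φ ∘ pointsMap`. -/
  obtain ⟨w, hw, φ, Φ₀, hX, hφ, hΔO, hΦ₀⟩ := exists_goodReduction_localModel W v hgood
  have hvO : w.Integers w.valuationSubring := Valuation.valuationSubring.integers w
  let A : geomPoints W →+ (((W.localMinimalIntegralModel v).map φ).baseChange
      (AlgebraicClosure (v.adicCompletion K))).toAffine.Point :=
    ((Φ₀.trans (Affine.Point.congrEquiv hX)).toAddMonoidHom).comp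
      (pointsMap W (v.adicCompletion K))
  have hAdef : ∀ X, A X = Affine.Point.congrEquiv hX (Φ₀ (pointsMap W (v.adicCompletion K) X)) :=
    fun X ↦ rfl
  have hAinj : Function.Injective A := fun X Y hXY ↦
    pointsMapOfEmb_injective W (closureEmb (K := K) (v.adicCompletion K))
      (Φ₀.injective ((Affine.Point.congrEquiv hX).injective hXY))
  let σE : absoluteGaloisGroup (v.adicCompletion K) →
      (AlgebraicClosure (v.adicCompletion K) →ₐ[v.adicCompletion K]
        AlgebraicClosure (v.adicCompletion K)) := fun σ ↦
    ((absoluteGaloisGroup.toAlgEquiv (v.adicCompletion K) σ :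
        AlgebraicClosure (v.adicCompletion K) ≃ₐ[v.adicCompletion K]
          AlgebraicClosure (v.adicCompletion K)) :
      AlgebraicClosure (v.adicCompletion K) →ₐ[v.adicCompletion K]
        AlgebraicClosure (v.adicCompletion K))
  have hσE : ∀ σ z, σE σ z = σ • z := fun σ z ↦ rfl
  have hAσ : ∀ (σ : absoluteGaloisGroup (v.adicCompletion K)) (X : geomPoints W),
      A (absGaloisRestrict K (v.adicCompletion K) σ • X) =
        Affine.Point.congrEquiv hX (Affine.Point.map (σE σ)
          (Φ₀ (pointsMap W (v.adicCompletion K) X))) := by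
    intro σ X
    rw [hAdef, ← resGal_eq_absGaloisRestrict, pointsMap_smul, hΦ₀]
  -- `z(A(σ X)) = σ z(A X)`
  have hzσ : ∀ (σ : absoluteGaloisGroup (v.adicCompletion K)) (X : geomPoints W),
      (A (absGaloisRestrict K (v.adicCompletion K) σ • X)).zCoord = σ • (A X).zCoord := by
    intro σ X
    rw [hAσ, hAdef]
    rcases Φ₀ (pointsMap W (v.adicCompletion K) X) with _ | ⟨x, y, hxy⟩
    · rw [← Affine.Point.zero_def, Affine.Point.map_zero, _root_.map_zero, Affine.Point.zCoord_zero,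
        smul_zero]
    · rw [Affine.Point.map_some, Affine.Point.congrEquiv_some, Affine.Point.congrEquiv_some,
        Affine.Point.zCoord_some, Affine.Point.zCoord_some, hσE, hσE, absoluteGaloisGroup.smul_def,
        absoluteGaloisGroup.smul_def, absoluteGaloisGroup.smul_def, map_div₀, map_neg]
  /- Step 1: `MO_{K̄_v}` is `w`-integral; residue characteristic `p`. -/
  haveI hint : (((W.localMinimalIntegralModel v).map φ).baseChange
      (AlgebraicClosure (v.adicCompletion K))).IsIntegral w.integer := by
    refine isIntegral_of_exists_lift _ ⟨⟨_, ?_⟩, rfl⟩ ⟨⟨_, ?_⟩, rfl⟩ ⟨⟨_, ?_⟩, rfl⟩ ⟨⟨_, ?_⟩, rfl⟩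
      ⟨⟨_, ?_⟩, rfl⟩
    all_goals exact (Valuation.mem_integer_iff _ _).mpr (hvO.map_le_one _)
  have hpw : w ((p : ℕ) : AlgebraicClosure (v.adicCompletion K)) < 1 := by
    have h := spectralValuation_algebraMap_ringOfIntegers_lt_one (v := v) hw hpv
    rwa [map_natCast] at h
  have hpL : ((p : ℕ) : AlgebraicClosure (v.adicCompletion K)) ≠ 0 := Nat.cast_ne_zero.mpr hp0
  have hpw0 : 0 < w ((p : ℕ) : AlgebraicClosure (v.adicCompletion K)) :=
    (Valuation.pos_iff _).mpr hpL
  /- Step 2: every `P ∈ MO(K̄_v)[p]` affine has `|x| > 1` and `|p| |x|^{(p²-1)/2} = 1`. -/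
  have htors : ∀ {x y : AlgebraicClosure (v.adicCompletion K)}
      {h : (((W.localMinimalIntegralModel v).map φ).baseChange
        (AlgebraicClosure (v.adicCompletion K))).toAffine.Nonsingular x y},
      (p : ℤ) • (Affine.Point.some x y h : (((W.localMinimalIntegralModel v).map φ).baseChange
        (AlgebraicClosure (v.adicCompletion K))).toAffine.Point) = 0 →
      1 < w x ∧ w ((p : ℕ) : AlgebraicClosure (v.adicCompletion K)) * w x ^ ((p ^ 2 - 1) / 2) = 1 := by
    intro x y h hpP
    letI : Algebra (v.adicCompletionIntegers K) (AlgebraicClosure (v.adicCompletion K)) :=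
      ((algebraMap w.valuationSubring (AlgebraicClosure (v.adicCompletion K))).comp φ).toAlgebra
    have hcurve : (W.localMinimalIntegralModel v).map
        (algebraMap (v.adicCompletionIntegers K) (AlgebraicClosure (v.adicCompletion K))) =
        ((W.localMinimalIntegralModel v).map φ).baseChange (AlgebraicClosure (v.adicCompletion K)) := by
      rw [WeierstrassCurve.baseChange, WeierstrassCurve.map_map]
      rfl
    haveI : CharP (IsLocalRing.ResidueField (v.adicCompletionIntegers K)) p :=
      charP_residueField_adicCompletionIntegers hpv
    have hR : ∀ c : v.adicCompletionIntegers K,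
        w (algebraMap (v.adicCompletionIntegers K) (AlgebraicClosure (v.adicCompletion K)) c) ≤ 1 :=
      fun c ↦ hvO.map_le_one (φ c)
    have hΔ := isUnit_Δ_localMinimalIntegralModel hgood
    have hHasse := W.hasseCoeff_localMinimalIntegralModel_mem_maximalIdeal hp2 hpv hgood hss
    have hpP' : (p : ℤ) • (Affine.Point.some x y (hcurve ▸ h) :
        ((W.localMinimalIntegralModel v).map (algebraMap (v.adicCompletionIntegers K)
          (AlgebraicClosure (v.adicCompletion K)))).toAffine.Point) = 0 := by
      have := congrArg (Affine.Point.congrEquiv hcurve.symm) hpP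
      rwa [map_zsmul, Affine.Point.congrEquiv_some, _root_.map_zero] at this
    exact one_lt_valuation_X_of_prime_zsmul_eq_zero_of_hasseCoeff_mem hp2 hR hgen hpw hpL _ hΔ
      hHasse hpP'
  /- Step 3: `A(E[p]) ⊆ E₁`, and `|z(A X)|^{p²-1} = |p|` for `X ∈ E[p] ∖ 0`. -/
  have hker : ∀ X ∈ geomTorsion W p,
      A X ∈ FormalGroupChart.kernel w (((W.localMinimalIntegralModel v).map φ).baseChange
        (AlgebraicClosure (v.adicCompletion K))) := by
    intro X hXt
    have hpX : (p : ℤ) • A X = 0 := by rw [← map_zsmul, mem_torsionBy_iff.mp hXt, A.map_zero]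
    revert hpX
    rcases A X with _ | ⟨x, y, h⟩
    · intro; rw [← Affine.Point.zero_def]; exact zero_mem _
    · intro hpX; rw [FormalGroupChart.some_mem_kernel_iff h]; exact (htors hpX).1
  have hzval : ∀ X ∈ geomTorsion W p, X ≠ 0 →
      w (A X).zCoord ^ (p ^ 2 - 1) = w ((p : ℕ) : AlgebraicClosure (v.adicCompletion K)) := by
    intro X hXt hX0
    have hpX : (p : ℤ) • A X = 0 := by rw [← map_zsmul, mem_torsionBy_iff.mp hXt, A.map_zero]
    have hkX : A X ∈ FormalGroupChart.kernel w (((W.localMinimalIntegralModel v).map φ).baseChange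
        (AlgebraicClosure (v.adicCompletion K))) := hker X hXt
    have hA0 : A X ≠ 0 := fun h0 ↦ hX0 (hAinj (by rw [h0, A.map_zero]))
    revert hpX hkX hA0
    rcases A X with _ | ⟨x, y, h⟩
    · intro _ _ hA0; exact (hA0 (Affine.Point.zero_def).symm).elim
    · intro hpX hkX _
      obtain ⟨hx1, hxp⟩ := htors hpX
      obtain ⟨h1, -, -⟩ := FormalGroupChart.val_X_mul_val_zCoord_sq hkX
      rw [Affine.Point.zCoord_some]
      have heven : 2 * ((p ^ 2 - 1) / 2) = p ^ 2 - 1 := by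
        obtain ⟨m, hm⟩ := hp.out.odd_of_ne_two hp2
        subst hm
        have : (2 * m + 1) ^ 2 - 1 = 2 * (2 * m * m + 2 * m) := by
          rw [show (2 * m + 1) ^ 2 = 2 * (2 * m * m + 2 * m) + 1 by ring, Nat.add_sub_cancel]
        rw [this, Nat.mul_div_cancel_left _ two_pos]
      have h3 : w x ^ ((p ^ 2 - 1) / 2) * (w (-x / y) ^ 2) ^ ((p ^ 2 - 1) / 2) = 1 := by
        rw [← mul_pow, h1, one_pow]
      calc w (-x / y) ^ (p ^ 2 - 1) = (w (-x / y) ^ 2) ^ ((p ^ 2 - 1) / 2) := by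
            rw [← pow_mul, heven]
        _ = w ((p : ℕ) : AlgebraicClosure (v.adicCompletion K)) *
              (w x ^ ((p ^ 2 - 1) / 2) * (w (-x / y) ^ 2) ^ ((p ^ 2 - 1) / 2)) := by
            rw [← mul_assoc, hxp, one_mul]
        _ = w ((p : ℕ) : AlgebraicClosure (v.adicCompletion K)) := by rw [h3, mul_one]
  /- Step 4: the Kummer root `π`, `π^{q²-1} = p`, `|z(A X)| = |π|`. -/
  set π : AlgebraicClosure (v.adicCompletion K) :=
    (kummerRoot (v.adicCompletion K) hn ((p : ℕ) : 𝒪[v.adicCompletion K]) :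
      AlgebraicClosure (v.adicCompletion K)) with hπdef
  have hπ0 : π ≠ 0 := coe_kummerRoot_ne_zero hn hirr.ne_zero
  have hπnorm : algNorm (v.adicCompletion K) π ^ (p ^ 2 - 1) =
      algNorm (v.adicCompletion K) ((p : ℕ) : AlgebraicClosure (v.adicCompletion K)) := by
    rw [hπdef, algNorm_kummerRoot_pow, map_natCast]
  have hwπ : w π ^ (p ^ 2 - 1) = w ((p : ℕ) : AlgebraicClosure (v.adicCompletion K)) := by
    have h1 := hπnorm
    rw [← algNorm_pow] at h1
    have hle := (spectralValuation_le_iff_algNorm_le hw _ _).mpr h1.le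
    have hge := (spectralValuation_le_iff_algNorm_le hw _ _).mpr h1.ge
    rw [Valuation.map_pow] at hle hge
    exact le_antisymm hle hge
  have hwπ1 : w π < 1 := by
    by_contra hle
    rw [not_lt] at hle
    have : 1 ≤ w π ^ (p ^ 2 - 1) := one_le_pow₀ hle
    rw [hwπ] at this
    exact absurd hpw (not_lt.mpr this)
  have hwπ0 : 0 < w π := (Valuation.pos_iff _).mpr hπ0
  -- `|z(A X)| = |π|` on `E[p] ∖ 0`, `≤ |π|` on `E[p]`; the same for `algNorm`
  have hne : p ^ 2 - 1 ≠ 0 := by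
    have h3 : 3 ≤ p := by have := hp.out.two_le; omega
    have : 9 ≤ p ^ 2 := by nlinarith
    omega
  have hwz : ∀ X ∈ geomTorsion W p, X ≠ 0 → w (A X).zCoord = w π := by
    intro X hXt hX0
    have h1 : w (A X).zCoord ^ (p ^ 2 - 1) = w π ^ (p ^ 2 - 1) := by rw [hzval X hXt hX0, hwπ]
    exact (pow_left_inj₀ zero_le zero_le hne).mp h1
  have hwz_le : ∀ X ∈ geomTorsion W p, w (A X).zCoord ≤ w π := by
    intro X hXt
    by_cases hX0 : X = 0
    · subst hX0; rw [A.map_zero, Affine.Point.zCoord_zero, _root_.map_zero]; exact zero_le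
    · exact (hwz X hXt hX0).le
  have hnz : ∀ X ∈ geomTorsion W p, X ≠ 0 →
      algNorm (v.adicCompletion K) (A X).zCoord = algNorm (v.adicCompletion K) π := by
    intro X hXt hX0
    exact le_antisymm ((spectralValuation_le_iff_algNorm_le hw _ _).mp (hwz X hXt hX0).le)
      ((spectralValuation_le_iff_algNorm_le hw _ _).mp (hwz X hXt hX0).ge)
  have hπn0 : algNorm (v.adicCompletion K) π ≠ 0 := (algNorm_pos_iff.mpr hπ0).ne'
  have hnorm_div : ∀ X ∈ geomTorsion W p, algNorm (v.adicCompletion K) ((A X).zCoord / π) ≤ 1 := by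
    intro X hXt
    by_cases hX0 : X = 0
    · subst hX0; rw [A.map_zero, Affine.Point.zCoord_zero, zero_div, algNorm_zero]; exact zero_le_one
    · rw [algNorm_div, hnz X hXt hX0, div_self hπn0]
  /- Step 5: the map `θ : E[p] → k`, `X ↦ ι(z(A X)/π mod 𝔓)`. -/
  let θ : geomPoints W → k := fun X ↦
    ι (IsNonarchimedeanLocalField.residue (v.adicCompletion K) ((A X).zCoord / π))
  have hθdef : ∀ X, θ X =
      ι (IsNonarchimedeanLocalField.residue (v.adicCompletion K) ((A X).zCoord / π)) :=
    fun X ↦ rfl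
  have hθ0 : θ 0 = 0 := by
    rw [hθdef, A.map_zero, Affine.Point.zCoord_zero, zero_div, residue_zero, ι.map_zero]
  -- additivity (`z` is additive to first order on `E₁`, the error being `≤ |π|² < |π|`)
  have hθadd : ∀ X ∈ geomTorsion W p, ∀ Y ∈ geomTorsion W p, θ (X + Y) = θ X + θ Y := by
    intro X hXt Y hYt
    rw [hθdef, hθdef, hθdef, ← ι.map_add, A.map_add]
    congr 1
    set err := (A X + A Y).zCoord - (A X).zCoord - (A Y).zCoord with herr
    have herr_le : w err ≤ w π ^ 2 :=
      (FormalGroupChart.val_zCoord_add_sub_le (hker X hXt) (hker Y hYt)).trans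
        (pow_le_pow_left' (max_le (hwz_le X hXt) (hwz_le Y hYt)) 2)
    have herr_div_w : w (err / π) < 1 := by
      rw [map_div₀]
      calc w err / w π ≤ w π ^ 2 / w π := by gcongr
        _ = w π := by rw [sq, mul_div_cancel_right₀ _ hwπ0.ne']
        _ < 1 := hwπ1
    have herr_div : algNorm (v.adicCompletion K) (err / π) < 1 :=
      (spectralValuation_lt_one_iff_algNorm_lt_one hw _).mp herr_div_w
    have hsplit : (A X + A Y).zCoord / π = ((A X).zCoord / π + (A Y).zCoord / π) + err / π := by
      rw [herr]; ring
    have hsum_le : algNorm (v.adicCompletion K) ((A X).zCoord / π + (A Y).zCoord / π) ≤ 1 :=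
      (algNorm_add_le _ _).trans (max_le (hnorm_div X hXt) (hnorm_div Y hYt))
    rw [hsplit, residue_add hsum_le herr_div.le, residue_add (hnorm_div X hXt) (hnorm_div Y hYt),
      (residue_eq_zero_iff herr_div.le).mpr herr_div, add_zero]
  -- equivariance under inertia: `θ(σ X) = ψ₂(σ) θ(X)`
  have hθsmul : ∀ (σ : absInertia (v.adicCompletion K)), ∀ X ∈ geomTorsion W p,
      θ (absGaloisRestrict K (v.adicCompletion K) (σ : absoluteGaloisGroup (v.adicCompletion K)) • X) =
        (kummerCharacter (v.adicCompletion K) hn hirr.ne_zero ι σ : k) * θ X := by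
    intro σ X hXt
    by_cases hX0 : X = 0
    · subst hX0; rw [smul_zero, hθ0, mul_zero]
    rw [hθdef, hθdef, hzσ]
    have hz0 : (A X).zCoord ≠ 0 := by
      intro h0
      exact hX0 (hAinj (((FormalGroupChart.zCoord_eq_zero_iff (hker X hXt)).mp h0).trans
        A.map_zero.symm))
    have hsplit : (σ : absoluteGaloisGroup (v.adicCompletion K)) • (A X).zCoord / π =
        ((σ : absoluteGaloisGroup (v.adicCompletion K)) • (A X).zCoord / (A X).zCoord) *
          ((A X).zCoord / π) := by
      field_simp
    have hn1 : algNorm (v.adicCompletion K)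
        ((σ : absoluteGaloisGroup (v.adicCompletion K)) • (A X).zCoord / (A X).zCoord) ≤ 1 :=
      (algNorm_smul_div_self _ hz0).le
    rw [hsplit, residue_mul hn1 (hnorm_div X hXt), ι.map_mul]
    congr 1
    rw [coe_kummerCharacter_eq_residue_smul_div hn hirr.ne_zero ι σ]
    rw [hnz X hXt hX0, hπnorm, map_natCast]
  -- injectivity
  have hθinj : ∀ X ∈ geomTorsion W p, θ X = 0 → X = 0 := by
    intro X hXt hθX
    by_contra hX0
    have h1 : algNorm (v.adicCompletion K) ((A X).zCoord / π) = 1 := by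
      rw [algNorm_div, hnz X hXt hX0, div_self hπn0]
    have h2 : IsNonarchimedeanLocalField.residue (v.adicCompletion K) ((A X).zCoord / π) ≠ 0 := by
      intro h0
      rw [residue_eq_zero_iff h1.le, h1] at h0
      exact lt_irrefl _ h0
    rw [hθdef] at hθX
    exact h2 (residueEmbedding_injective ι (by rw [ι.map_zero]; exact hθX))
  exact ⟨θ, hθadd, hθinj, hθsmul⟩

end Summit.BirchSwinnertonDyer.BirchSwinnertonDyer.Theorems.SmallImageLambdaLowerThreeNsThetaPartner

end
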